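import Mathlib
import Summits.NavierStokesRegularity.NavierStokesRegularity.Theorems.TaoLadderRungTwoFlatCaptureHop
import HarnessLib

/-!
# K4, CAPTURE PHASE: the a-priori weighted bound on the WHOLE CLOCK WINDOW `[0, c]` along every exact flow from a ball state of a capture
  hop (`n ≤ N₀`), in an admissible gauge — the `hapr` input of `tubeExistWith_of_apriori` for those hops
  (helper for the K_A♭ parent item stmt-NavierStokesRegularity-22987 `FlatGapCertificatesV2`, child 2A `GradedAdiabaticWakeA` of route
  TaoLadderRungTwoFlat; cell harvest/h2-tao-ladder, p1 g25; LADDER §47.5 L2 (existence), §50 (`TubeExist`, K4))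

`tubeExistWith_of_apriori` (p729549) reduces the format's (exist₀) clause for the tube to: for every tube state `z` and ball state `S₀`, SOME `B`
bounds `ω_k|S_{ik}(t)|` along EVERY exact flow from `S₀` on every `[0, s] ⊆ [0, c]` (`ω` an admissible Banach weight, growing like `(1+ε₀)^{10k}`
ahead). At a capture hop the reference flow `Z` of the hop (exact graded flow from the centre `ζ n`, now on the whole `[0, c]` and bounded in
the gauge `ω`) controls every such flow by the a-priori-free continuity in the gauge `ω` (`gauge_deviation_of_gradedFlows_free`, the
general-gauge form of `sup_deviation_of_gradedFlows`): `ω|S − Z| ≤ ½`, hence `ω|S| ≤ M_Z^ω + ½`.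

* `gauge_deviation_of_gradedFlows_free` — general gauge `ω ≥ c`, `ω/c` window-regular;
* `captureStart_le_gauge` — the initial `ω`-distance `≤ (5/4)Ω_w r + Ω_{k₁} η n` (`ω ≤ Ω_w·w`, `ω ≤ Ω_{k₁}` below `k₁`);
* `apriori_capture_of_continuity` — the `hapr` clause of `tubeExistWith_of_apriori` at a hop `n ≤ N₀`.

HONEST FRAMING: finite-time estimates about MODEL-lattice flows (graded mirror table on `S♭`); reference flows, their bounds and the smallness
rows are HYPOTHESES; nothing certified; no item closed; nothing about the Navier–Stokes equations.
-/

noncomputable section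

-- the sub-problem namespace repeats the summit name by design (D-0017)
set_option linter.dupNamespace false

namespace Summit.NavierStokesRegularity.NavierStokesRegularity.Theorems.HopTube

open Set Finset Literature.Analysis.FluidPDE Literature.Analysis.FluidPDE.TaoCascade MirrorPulse RenormFrame QuadPolar
  GappedFrontRobustOn

/-- **FINITE-TIME CONTINUITY OF EXACT GRADED FLOWS, A-PRIORI-FREE, IN A GENERAL GAUGE** `ω ≥ c` with `ω/c` window-regular (`Λ_g`): reference
bound `c|W| ≤ M_W`, `ω_k|S₀ − W₀|_k ≤ B`, `B·e^{Lτ} ≤ ½` with `L = 2‖α̃‖₁(M_W+1)Λ_g` ⇒ `ω_k|S_k(s) − W_k(s)| ≤ B·e^{Ls}` on `[0, τ]` (the gauge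
`max(1, c)` of `sup_deviation_of_gradedFlows` is the instance `Λ_g = (1+ε₀)^{5/2}`; admissible Banach weights `(1+ε₀)^{10k⁺}` are another).
[cite: Tao2016AveragedNS, §4 Lemma 4.1 (4.5), (4.8), §5 (continuity argument); route TaoLadderRungTwoFlat, capture hops / K4 (cell LADDER §47.5 L2/L3, §50)] -/
theorem gauge_deviation_of_gradedFlows_free {ε ε₀ τ : ℝ} {ω : ℤ → ℝ} {Λg : ℝ} {W₀ S₀ : Fin 2 → ℤ → ℝ} {W FW S FS : Fin 2 → ℤ → ℝ → ℝ}
    (hW : PseudoFlowOnShift shiftSetFlat τ ε₀ (mirrorTable ε ε) 0 0 W₀ (fun i k => (1 / 2) * W₀ i k ^ 2)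
      (fun _ _ => 0) W FW)
    (hS : PseudoFlowOnShift shiftSetFlat τ ε₀ (mirrorTable ε ε) 0 0 S₀ (fun i k => (1 / 2) * S₀ i k ^ 2)
      (fun _ _ => 0) S FS)
    (hε₀ : 0 < ε₀) (hτ : 0 ≤ τ) (hωc : ∀ k, clockW ε₀ k ≤ ω k)
    (hreg : IsWindowRegular (fun (_ : Fin 2) k => ω k / clockW ε₀ k) Λg) {MW B : ℝ} (hMW : 0 ≤ MW)
    (hWb : ∀ i k, ∀ t ∈ Icc 0 τ, clockW ε₀ k * |W i k t| ≤ MW)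
    (hB : ∀ i k, ω k * |S₀ i k - W₀ i k| ≤ B)
    (hsmall : B * Real.exp (2 * tableAbsSum shiftSetFlat (renormTable ε₀ (mirrorTable ε ε)) * (MW + 1)
      * Λg * τ) ≤ 1 / 2) :
    ∀ (i : Fin 2) (k : ℤ), ∀ s ∈ Icc 0 τ, ω k * |S i k s - W i k s|
      ≤ B * Real.exp (2 * tableAbsSum shiftSetFlat (renormTable ε₀ (mirrorTable ε ε)) * (MW + 1)
          * Λg * s) := by
  have hε' : (-1 : ℝ) < ε₀ := by linarith
  have hc : ∀ k, 0 < clockW ε₀ k := clockW_pos hε'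
  have hT0 : 0 ≤ tableAbsSum shiftSetFlat (renormTable ε₀ (mirrorTable ε ε)) := tableAbsSum_nonneg _ _
  have hL0 : 0 ≤ 2 * tableAbsSum shiftSetFlat (renormTable ε₀ (mirrorTable ε ε)) * (MW + 1) * Λg := by
    have : 0 ≤ Λg := zero_le_one.trans hreg.2.1
    positivity
  have hB0 : 0 ≤ B := le_trans (mul_nonneg ((clockW_pos hε' 0).le.trans (hωc 0)) (abs_nonneg _)) (hB 0 0)
  have hexpτ : ∀ t, t ≤ τ →
      B * Real.exp (2 * tableAbsSum shiftSetFlat (renormTable ε₀ (mirrorTable ε ε)) * (MW + 1) * Λg * t)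
        ≤ 1 / 2 := fun t ht =>
    (mul_le_mul_of_nonneg_left (Real.exp_le_exp.mpr (mul_le_mul_of_nonneg_left ht hL0)) hB0).trans hsmall
  -- the finite set of shells where `c|S| ≤ MW + 1` is not automatic
  have hMc : 0 < MW + 1 := by linarith
  obtain ⟨k₀, hk₀0, hk₀⟩ := R54.clockW_abs_eventually_le hS hε₀ hMc
  obtain ⟨kl, hkl0, hkl⟩ := clockW_abs_le_behind hS hε₀ hMc
  set I : Finset (Fin 2 × ℤ) := Finset.univ ×ˢ Finset.Icc kl k₀ with hI
  have hIne : I.Nonempty := ⟨(0, 0), by simp only [hI, Finset.mem_product, Finset.mem_univ, Finset.mem_Icc, true_and]; omega⟩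
  set f : ℝ → ℝ := fun t => I.sup' hIne (fun p => clockW ε₀ p.2 * |S p.1 p.2 t|) with hf
  have hScont : ∀ i k, ContinuousOn (S i k) (Icc 0 τ) := fun i k => continuousOn_of_pseudoFlowOnShift hS i k
  have hfcont : ContinuousOn f (Icc 0 τ) :=
    ContinuousOn.finset_sup'_apply hIne fun p _ => continuousOn_const.mul (hScont p.1 p.2).abs
  -- "f ≤ MW + 1 on [0, t]" ⇒ every shell obeys `c|S| ≤ MW + 1` on `[0, t]`
  have hall : ∀ t, t ≤ τ → (∀ s ∈ Icc 0 t, f s ≤ MW + 1) →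
      ∀ (i : Fin 2) (k : ℤ), ∀ s ∈ Icc 0 t, clockW ε₀ k * |S i k s| ≤ MW + 1 := by
    intro t htτ hft i k s hs
    have hsτ : s ∈ Icc 0 τ := ⟨hs.1, hs.2.trans htτ⟩
    rcases lt_or_ge k₀ k with hk | hk
    · exact hk₀ k hk i s hsτ
    rcases lt_or_ge k kl with hk' | hk'
    · exact hkl k hk' i s hsτ
    · have hp : (i, k) ∈ I := by
        simp only [hI, Finset.mem_product, Finset.mem_univ, Finset.mem_Icc, true_and]; exact ⟨hk', hk⟩
      exact (Finset.le_sup' (fun p : Fin 2 × ℤ => clockW ε₀ p.2 * |S p.1 p.2 s|) hp).trans (hft s hs)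
  -- Grönwall on an initial segment `[0, t]` under the background bound
  have hgron : ∀ t, 0 < t → t ≤ τ → (∀ (i : Fin 2) (k : ℤ), ∀ s ∈ Icc 0 t, clockW ε₀ k * |S i k s| ≤ MW + 1) →
      ∀ (i : Fin 2) (k : ℤ), ∀ s ∈ Icc 0 t, ω k * |S i k s - W i k s|
        ≤ B * Real.exp (2 * tableAbsSum shiftSetFlat (renormTable ε₀ (mirrorTable ε ε)) * (MW + 1)
            * Λg * s) := by
    intro t ht htτ hSb i k s hs
    have hS' := pseudoFlowOnShift_mono hS ht htτ
    have hW' := pseudoFlowOnShift_mono hW ht htτ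
    have hWb' : ∀ (i : Fin 2) (k : ℤ), ∀ s ∈ Icc 0 t, clockW ε₀ k * |W i k s| ≤ MW + 1 := fun i k s hs =>
      (hWb i k s ⟨hs.1, hs.2.trans htτ⟩).trans (by linarith)
    exact gauge_deviation_of_gradedFlows hW' hS' hε₀.le (ω := fun (_ : Fin 2) k => ω k) hreg hSb hWb' hB i k hs
  -- the initial clock-weighted bound of `S`
  have hinit : ∀ (i : Fin 2) (k : ℤ), clockW ε₀ k * |S i k 0| ≤ MW + 1 / 2 := by
    intro i k
    have hw0 := hWb i k 0 ⟨le_rfl, hτ⟩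
    rw [hW.init_S] at hw0
    rw [hS.init_S]
    have htri := abs_sub_abs_le_abs_sub (S₀ i k) (W₀ i k)
    have h1 : clockW ε₀ k * |S₀ i k - W₀ i k| ≤ B :=
      (mul_le_mul_of_nonneg_right (hωc k) (abs_nonneg _)).trans (hB i k)
    have hB2 : B ≤ 1 / 2 := by
      have := hexpτ 0 hτ
      rwa [mul_zero, Real.exp_zero, mul_one] at this
    nlinarith [hc k]
  -- continuous induction on the finite sup
  have hboot := Bootstrap.Icc_induction (f := f) (a := MW + 1) (b := MW + 1 / 2) hτ hfcont (by linarith)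
    (Finset.sup'_le hIne _ fun p _ => hinit p.1 p.2) (by
      intro t ht hft
      refine Finset.sup'_le hIne _ fun p _ => ?_
      rcases eq_or_lt_of_le ht.1 with h0 | htpos
      · rw [← h0]; exact hinit p.1 p.2
      · have hSb := hall t ht.2 hft
        have hd := hgron t htpos ht.2 hSb p.1 p.2 t ⟨ht.1, le_rfl⟩
        have hw := hWb p.1 p.2 t ht
        have h2 : clockW ε₀ p.2 * |S p.1 p.2 t - W p.1 p.2 t| ≤ 1 / 2 :=
          ((mul_le_mul_of_nonneg_right (hωc p.2) (abs_nonneg _)).trans hd).trans (hexpτ t ht.2)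
        have htri := abs_sub_abs_le_abs_sub (S p.1 p.2 t) (W p.1 p.2 t)
        nlinarith [hc p.2])
  -- conclusion: the background bound holds on `[0, τ]`, so Grönwall applies on the whole window
  intro i k s hs
  rcases eq_or_lt_of_le hτ with h0 | hτpos
  · have hs0 : s = 0 := le_antisymm (h0 ▸ hs.2) hs.1
    subst hs0
    rw [hS.init_S, hW.init_S, mul_zero, Real.exp_zero, mul_one]
    exact hB i k
  · exact hgron τ hτpos le_rfl (hall τ le_rfl fun s hs => (hboot s hs).trans (by linarith)) i k s hs

/-- **The initial `ω`-distance of a capture premise to the centre** (`ω ≤ Ω_w·w` everywhere, `ω ≤ Ω_{k₁}` below `k₁`): kick, capture ball and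
both tails give `ω_k|S₀ − ζ n|_k ≤ (5/4)·Ω_w·r + Ω_{k₁}·η n`. [cite: Tao2016AveragedNS, §6.2 Prop. 6.3 (ix), §6.3–6.4 (statement shape); cell LADDER §47.5, §50] -/
theorem captureStart_le_gauge (P : TubeSchedule) {ω w : ℤ → ℝ} {r Ωw Ωk : ℝ} {ζ : ℕ → Fin 2 → ℤ → ℝ} {n : ℕ}
    {z S₀ : Fin 2 → ℤ → ℝ} (hcap : CaptureClause P ζ n z) (hA : AheadClause P w r z) (hζA : AheadClause P w r (ζ n))
    (hkick : ∀ i k, w k * |S₀ i k - z i k| ≤ r) (hw1 : ∀ k, 1 ≤ w k) (hω0 : ∀ k, 0 ≤ ω k)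
    (hΩw : 0 ≤ Ωw) (hωw : ∀ k, ω k ≤ Ωw * w k) (hΩk : 0 ≤ Ωk) (hωk : ∀ k, k < (P.k₁ : ℤ) → ω k ≤ Ωk)
    (hr : 0 ≤ r) (hη : 0 ≤ P.η n) {B : ℝ} (hB : 5 / 4 * Ωw * r + Ωk * P.η n ≤ B) :
    ∀ (i : Fin 2) (k : ℤ), ω k * |S₀ i k - ζ n i k| ≤ B := by
  intro i k
  have hwk : 0 < w k := lt_of_lt_of_le one_pos (hw1 k)
  have hkick' : |S₀ i k - z i k| ≤ r / w k := by rw [le_div_iff₀ hwk, mul_comm]; exact hkick i k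
  have hωr : ω k * (r / w k) ≤ Ωw * r := by
    calc ω k * (r / w k) ≤ Ωw * w k * (r / w k) := mul_le_mul_of_nonneg_right (hωw k) (div_nonneg hr hwk.le)
      _ = Ωw * r := by field_simp
  have htri : |S₀ i k - ζ n i k| ≤ |S₀ i k - z i k| + |z i k - ζ n i k| := by
    have := abs_add_le (S₀ i k - z i k) (z i k - ζ n i k); simp only [sub_add_sub_cancel] at this; exact this
  have hΩη : 0 ≤ Ωk * P.η n := mul_nonneg hΩk hη
  rcases lt_or_ge k (P.k₁ : ℤ) with hk | hk
  · -- below `k₁`: kick + capture ball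
    have hcη : ω k * |z i k - ζ n i k| ≤ Ωk * P.η n := mul_le_mul (hωk k hk) (hcap i k) (abs_nonneg _) hΩk
    calc ω k * |S₀ i k - ζ n i k| ≤ ω k * (|S₀ i k - z i k| + |z i k - ζ n i k|) := mul_le_mul_of_nonneg_left htri (hω0 k)
      _ ≤ ω k * (r / w k) + ω k * |z i k - ζ n i k| := by
          rw [mul_add]; exact add_le_add (mul_le_mul_of_nonneg_left hkick' (hω0 k)) le_rfl
      _ ≤ Ωw * r + Ωk * P.η n := add_le_add hωr hcη
      _ ≤ B := by nlinarith
  · -- from `k₁` on: kick + both tails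
    have hz8 := hA i k hk
    have hζ8 := hζA i k hk
    have hz' : |z i k| ≤ r / (8 * w k) := by rw [le_div_iff₀ (by positivity)]; linarith
    have hζ' : |ζ n i k| ≤ r / (8 * w k) := by rw [le_div_iff₀ (by positivity)]; linarith
    have hzζ : |z i k - ζ n i k| ≤ r / (8 * w k) + r / (8 * w k) := (abs_sub _ _).trans (add_le_add hz' hζ')
    have hsum : |S₀ i k - ζ n i k| ≤ 5 / 4 * (r / w k) := by
      have e : r / (8 * w k) + r / (8 * w k) = 1 / 4 * (r / w k) := by field_simp; ring
      linarith [htri, hkick', hzζ]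
    calc ω k * |S₀ i k - ζ n i k| ≤ ω k * (5 / 4 * (r / w k)) := mul_le_mul_of_nonneg_left hsum (hω0 k)
      _ = 5 / 4 * (ω k * (r / w k)) := by ring
      _ ≤ 5 / 4 * (Ωw * r) := by linarith
      _ ≤ B := by linarith

section AprioriCapture

variable {ε ε₀ : ℝ}

/-- **K4 AT A CAPTURE HOP: the a-priori `ω`-bound on the whole clock window.** For `n ≤ N₀`, a tube state `z` and a ball state `S₀`, every exact
flow from `S₀` on `[0, s] ⊆ [0, c]` obeys `ω_k|S_{ik}(t)| ≤ M_Z^ω + ½` (and so does `S₀`), given the reference flow `Z` of the hop on `[0, c]` with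
`ω|Z| ≤ M_Z^ω`, the gauge data (`c ≤ ω ≤ Ω_w·w`, `ω ≤ Ω_{k₁}` below `k₁`, `ω/c` window-regular) and the smallness
`((5/4)Ω_w r + Ω_{k₁} η n)·e^{2‖α̃‖₁(M_Z^ω+1)Λ_g c} ≤ ½` — literally the `hapr` clause of `tubeExistWith_of_apriori` at hop `n`.
[cite: Tao2016AveragedNS, §4 Lemma 4.1 (4.5), (4.12), §5; route TaoLadderRungTwoFlat, `HopTube.TubeExistWith` (cell LADDER §47.5 L2, K4)] -/
theorem apriori_capture_of_continuity (P : TubeSchedule) {Bcl : ℕ → (Fin 2 → ℤ → ℝ) → Prop} {i₀ : Fin 2} {X₀ : Fin 2 → ℝ}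
    {w ω : ℤ → ℝ} {r c Λg Ωw Ωk : ℝ} {ζ : ℕ → Fin 2 → ℤ → ℝ} {ustar : Fin 2 → ℤ → ℝ} {n : ℕ} {Z FZ : Fin 2 → ℤ → ℝ → ℝ}
    (hε₀ : 0 < ε₀) (hn : n ≤ P.N₀) (hc : 0 < c)
    (hζ0 : ζ 0 = datumState i₀ X₀) (hη0 : 0 ≤ P.η 0) (hηn : 0 ≤ P.η n) (hk₁ : 1 ≤ P.k₁) (hr0 : 0 ≤ r) (hw1 : ∀ k, 1 ≤ w k)
    (hωc : ∀ k, clockW ε₀ k ≤ ω k) (hreg : IsWindowRegular (fun (_ : Fin 2) k => ω k / clockW ε₀ k) Λg)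
    (hΩw : 0 ≤ Ωw) (hωw : ∀ k, ω k ≤ Ωw * w k) (hΩk : 0 ≤ Ωk) (hωk : ∀ k, k < (P.k₁ : ℤ) → ω k ≤ Ωk)
    (hZ : PseudoFlowOnShift shiftSetFlat c ε₀ (mirrorTable ε ε) 0 0 (ζ n) (fun i k => (1 / 2) * ζ n i k ^ 2) (fun _ _ => 0) Z FZ)
    {MZω : ℝ} (hMZω : 0 ≤ MZω) (hZω : ∀ i k, ∀ t ∈ Icc 0 c, ω k * |Z i k t| ≤ MZω)
    (hζA : AheadClause P w r (ζ n))
    (hsmall : (5 / 4 * Ωw * r + Ωk * P.η n)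
      * Real.exp (2 * tableAbsSum shiftSetFlat (renormTable ε₀ (mirrorTable ε ε)) * (MZω + 1) * Λg * c) ≤ 1 / 2)
    {z S₀ : Fin 2 → ℤ → ℝ} (hz : InTubeWith P Bcl i₀ X₀ w r ζ ustar n z) (hkick : ∀ i k, w k * |S₀ i k - z i k| ≤ r) :
    (∀ (i : Fin 2) (k : ℤ), ω k * |S₀ i k| ≤ MZω + 1 / 2) ∧
      ∀ s : ℝ, 0 < s → s ≤ c → ∀ S FS : Fin 2 → ℤ → ℝ → ℝ,
        PseudoFlowOnShift shiftSetFlat s ε₀ (mirrorTable ε ε) 0 0 S₀ (fun i k => (1 / 2) * S₀ i k ^ 2) (fun _ _ => 0) S FS →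
          ∀ t ∈ Icc 0 s, ∀ (i : Fin 2) (k : ℤ), ω k * |S i k t| ≤ MZω + 1 / 2 := by
  have hε' : (-1 : ℝ) < ε₀ := by linarith
  have hcpos : ∀ k, 0 < clockW ε₀ k := clockW_pos hε'
  have hω0 : ∀ k, 0 ≤ ω k := fun k => (hcpos k).le.trans (hωc k)
  obtain ⟨hcap, hA⟩ := capture_of_inTubeWith_le P hn hζ0 hη0 hk₁ hr0 hz
  have hB := captureStart_le_gauge P hcap hA hζA hkick hw1 hω0 hΩw hωw hΩk hωk hr0 hηn le_rfl
  have hZc : ∀ i k, ∀ t ∈ Icc 0 c, clockW ε₀ k * |Z i k t| ≤ MZω := fun i k t ht =>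
    (mul_le_mul_of_nonneg_right (hωc k) (abs_nonneg _)).trans (hZω i k t ht)
  have hL0 : 0 ≤ 2 * tableAbsSum shiftSetFlat (renormTable ε₀ (mirrorTable ε ε)) * (MZω + 1) * Λg := by
    have : 0 ≤ Λg := zero_le_one.trans hreg.2.1
    have := tableAbsSum_nonneg shiftSetFlat (renormTable ε₀ (mirrorTable ε ε))
    positivity
  have hB0 : 0 ≤ 5 / 4 * Ωw * r + Ωk * P.η n := le_trans (mul_nonneg (hω0 0) (abs_nonneg _)) (hB 0 0)
  have hBhalf : 5 / 4 * Ωw * r + Ωk * P.η n ≤ 1 / 2 :=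
    (le_mul_of_one_le_right hB0 (Real.one_le_exp (mul_nonneg hL0 hc.le))).trans hsmall
  refine ⟨fun i k => ?_, fun s hs hsc S FS hS t ht i k => ?_⟩
  · -- the start state: `ω|S₀| ≤ ω|ζ n| + B ≤ M + ½`
    have h0 := hZω i k 0 ⟨le_rfl, hc.le⟩
    rw [hZ.init_S] at h0
    have htri := abs_sub_abs_le_abs_sub (S₀ i k) (ζ n i k)
    nlinarith [hB i k, hω0 k]
  · have hZ' := pseudoFlowOnShift_mono hZ hs hsc
    have hsmall' : (5 / 4 * Ωw * r + Ωk * P.η n)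
        * Real.exp (2 * tableAbsSum shiftSetFlat (renormTable ε₀ (mirrorTable ε ε)) * (MZω + 1) * Λg * s) ≤ 1 / 2 :=
      (mul_le_mul_of_nonneg_left (Real.exp_le_exp.mpr (mul_le_mul_of_nonneg_left hsc hL0)) hB0).trans hsmall
    have hd := gauge_deviation_of_gradedFlows_free hZ' hS hε₀ hs.le hωc hreg hMZω
      (fun i k t ht => hZc i k t ⟨ht.1, ht.2.trans hsc⟩) hB hsmall' i k t ht
    have hdev : ω k * |S i k t - Z i k t| ≤ 1 / 2 :=
      hd.trans ((mul_le_mul_of_nonneg_left (Real.exp_le_exp.mpr (mul_le_mul_of_nonneg_left ht.2 hL0)) hB0).trans hsmall')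
    have hZt := hZω i k t ⟨ht.1, ht.2.trans hsc⟩
    have htri := abs_sub_abs_le_abs_sub (S i k t) (Z i k t)
    nlinarith [hω0 k]

end AprioriCapture

end Summit.NavierStokesRegularity.NavierStokesRegularity.Theorems.HopTube

end
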